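/-
Copyright (c) 2026 the pub-hodgecm-mathlib formalisation cell (harness21).  Prover seat hodgecm-mathlib-LH4-p11 (g9), req620 Track A «(D-RAM) FOUR-FRAME» squad, helper lane on
h413 = stmt-HodgeConjecture-24833 (count-neutral).  β chair F0P3a-p01 (g37) LEDGER #14 (`hR6₁` «above» half): the TOWER-1 twin of ★ p861708 — the clean-shell dictionary of the G₁ strata off the glue foot WITHOUT a cell or a
guard, and the zero row it yields.  Pattern: ★ p860827 `shell_iff_of_mem_stratum_G1` (this lineage, g8) + ★ p861708.  2026-09-04.
-/
import Summits.HodgeConjecture.HodgeConjecture.Theorems.F0P3cDyRamLabelledGluedStratumRead     -- ★ p859257 (LH4-p09 (g8)): `latticeInLevel_diagonal_latt_G1_iff{_of_ne}`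
import Summits.HodgeConjecture.HodgeConjecture.Theorems.F0P3cDyRamDiagonalGluedStratum          -- ★ (F0P3-p01 (g31)): `stratum_G1_eq`
import Summits.HodgeConjecture.HodgeConjecture.Theorems.F0P3cDyRamStageOneBDefs                -- ★ DEFS №5: `mcOfRecord`
import Summits.HodgeConjecture.HodgeConjecture.Theorems.F0P3cDyRamLabelledSplitStrata           -- ★ p859094 (F0P3a-p01): `finsum_mem_sep_eq_ite_of_forall_iff`
import Summits.HodgeConjecture.HodgeConjecture.Theorems.F0P3cDyRamLabelledOddCountDefs          -- ★ p860257 DEFS (LH4-p11 (g8)): `labelledOddCount`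
import HarnessLib

/-!
# Crux `H413`, line LH4 «(D-RAM) FOUR-FRAME» — (β-BAL) Stage B, THE TOWER-1 REST COLUMN: the clean shell on `G₁(ρ, s) = (2ρ, 2ρ+s, 2ρ+s)` OFF THE GLUE FOOT `n₁ ≠ n₂ + s`,
# with NO cell and NO guard — `shell ⟺ READ ∨ κ-LOCUS` — and the ZERO ROW off both (the tower-1 twin of ★ p861708, asked by the β chair F0P3a-p01 (g37) LEDGER #14 for `hR6₁`'s «above» half)

Cell `hodgecm-mathlib` (D-0151), FLOOR 0, crux item H413 = `stmt-HodgeConjecture-24833`, route `HCCMUnconditional`; squad F0∕P3c∕LH4.  THEOREMS ONLY (no `def`, no instance, no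
notation, no `sorry`, default heartbeats); ★-only imports; lane `--supports stmt-HodgeConjecture-24833 --as helper` (count-neutral); pays NO row, states NO law.
WHAT.  Off the glue foot `n₁ ≠ n₂ + s` the level tokens of `X = diag(α−1, β−1, 0)` on the G₁ normal form `latt (1 0 0; x ϖ^ρ 0; xζ+y″ ϖ^ρζ ϖ^{2ρ+s})` are constant reads
(★ p859257 `latticeInLevel_diagonal_latt_G1_iff_of_ne`): the X-level is `min(n₃ − ρ, n₁ − 2ρ − s, n₂ − 2ρ)`.  The clean shell (level EXACTLY `ℓ₀`, square token at `mcOfRecord d`) is met iff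
that minimum is `ℓ₀`; the `n₃`-branch is void by the isosceles rule (`n₃ < min n₁ n₂` is impossible), the square token is automatic in the other two, so
* §1 HEAD **`shell_iff_of_mem_stratum_G1_offFoot`** (`ρ, s ≥ 1`, `mcOfRecord d ≤ N₀`, ANY `T`, `n₁ ≠ n₂ + s`): for every `M ∈ stratum σ ϖ T (2ρ, 2ρ+s, 2ρ+s)`,
  `shell M ↔ (2ρ + s + ℓ₀ = n₁ ∧ 2ρ + ℓ₀ + 1 ≤ n₂) ∨ (2ρ + ℓ₀ = n₂ ∧ 2ρ + s + ℓ₀ < n₁)` — the READ (★ p860827's cell column ∕ R3 beyond) OR the κ-LOCUS (R6₁, ★ p861745∕p861844∕p861894);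
  in the cell `2ρ + m* ≤ n₂` this is ★ `shell_iff_of_mem_stratum_G1` (there the κ-branch is void).
* §2 **`finsum_stratum_G1_shell_eq_zero_offFoot`** — off the foot, off the read and off the κ-locus the clean-shell cut is EMPTY: `Σᶠ_{cut} labelledOddCount∕w = 0` for ANY label, weight, slot —
  in particular the «ABOVE» half of `hR6₁` (`2ρ + ℓ₀ = n₂`, `2ρ + s + ℓ₀ > n₁`, off the foot) is `0` by name.
HONEST LABEL.  Count-neutral (`--supports`); nothing printed is asserted; hR6₁'s κ-branch SUM (R6b), the foot rows, hRest, (β) `stub_law_cleanSgn`, T₊ remain OPEN; `HC_CM` is proved only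
modulo the 7 printed citations (2 remaining named inputs: hLiu418 = `stmt-HodgeConjecture-24832`, h413 = `stmt-HodgeConjecture-24833`) until rung 0 closes.
References: [Kottwitz1986BaseChangeUnits] §1 pp. 240–241 · [Rogawski1990] §4.9 Prop. 4.9.1 (a)(b) p. 55 · [Serre1980Trees] Ch. II §1.1.
-/

set_option autoImplicit false

noncomputable section

namespace Summit.HodgeConjecture.HodgeConjecture.Cruxes.H413.F0P3cDyRamLabelledOddOffFootShellG1

open Literature.NumberTheory.Automorphic Literature.NumberTheory.Automorphic.HermitianLattice
open Literature.NumberTheory.Automorphic.UnitaryLatticeTree Literature.NumberTheory.Automorphic.UnitaryThreeFourFrame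
open Summit.HodgeConjecture.HodgeConjecture.Cruxes.H413.F0P3cDyRamFourFramePieces
open Summit.HodgeConjecture.HodgeConjecture.Cruxes.H413.F0P3cDyRamFourFrameCensusDefs
open Summit.HodgeConjecture.HodgeConjecture.Cruxes.H413.F0P3cDyRamStageOneBDefs (mcOfRecord)
open Summit.HodgeConjecture.HodgeConjecture.Cruxes.H413.F0P3cDyRamDiagonalTorusDefs
open Summit.HodgeConjecture.HodgeConjecture.Cruxes.H413.F0P3cDyRamDiagonalStrataDefs
open Summit.HodgeConjecture.HodgeConjecture.Cruxes.H413.F0P3cDyRamLabelledOddCountDefs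
open Summit.HodgeConjecture.HodgeConjecture.Cruxes.H413.F0P3cDyRamDiagonalGluedStratum (stratum_G1_eq)
open Summit.HodgeConjecture.HodgeConjecture.Cruxes.H413.F0P3cDyRamLabelledGluedStratumRead (latticeInLevel_diagonal_latt_G1_iff latticeInLevel_diagonal_latt_G1_iff_of_ne)
open Summit.HodgeConjecture.HodgeConjecture.Cruxes.H413.F0P3cDyRamLabelledSplitStrata (finsum_mem_sep_eq_ite_of_forall_iff)
open scoped Valued WithZero Matrix MatrixGroups

variable {K : Type} [Field K] [Valued K ℤᵐ⁰] {σ : K →+* K} {ϖ : K} {d t : ℕ} {α β : K} {N₀ n₁ n₂ n₃ : ℕ}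

/-! ## §1  The clean shell off the glue foot: READ ∨ κ-LOCUS -/

/-- **THE CLEAN-SHELL DICTIONARY ON `G₁(ρ, s)` OFF THE GLUE FOOT** (`ρ, s ≥ 1`, `mcOfRecord d ≤ N₀`, ANY `T`; `n₁ ≠ n₂ + s`): for every member of the stratum `(2ρ, 2ρ+s, 2ρ+s)`,
the three shell tokens of `X = diag(α−1, β−1, 0)` hold iff `(2ρ + s + ℓ₀ = n₁ ∧ 2ρ + ℓ₀ + 1 ≤ n₂)` (the READ) `∨ (2ρ + ℓ₀ = n₂ ∧ 2ρ + s + ℓ₀ < n₁)` (the κ-LOCUS) — the X-level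
`min(n₃ − ρ, n₁ − 2ρ − s, n₂ − 2ρ)` is `ℓ₀` exactly in these two ways only (the `n₃`-branch is void by the isosceles rule), the square token being automatic in both.  No cell, no guard.
[cite: Kottwitz1986BaseChangeUnits, §1 pp. 240–241] [cite: Rogawski1990, §4.9 Prop. 4.9.1 (a) p. 55] [cite: Serre1980Trees, Ch. II §1.1] -/
theorem shell_iff_of_mem_stratum_G1_offFoot (hD : IsRamifiedQuadraticDatum σ ϖ d t)
    (hE : IsElementDatum σ ϖ N₀ α β n₁ n₂ n₃) (hmc : mcOfRecord d ≤ N₀)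
    (T : GL (Fin 3) K) (ρ s : ℕ) (hρ : 1 ≤ ρ) (hs : 1 ≤ s) (hfoot : n₁ ≠ n₂ + s) :
    ∀ M ∈ stratum σ ϖ T ![2 * ρ, 2 * ρ + s, 2 * ρ + s],
      (LatticeInLevel ϖ (d % 2) (Matrix.diagonal ![α - 1, β - 1, 0]) M ∧ ¬ LatticeInLevel ϖ (d % 2 + 1) (Matrix.diagonal ![α - 1, β - 1, 0]) M ∧
          LatticeInLevel ϖ (mcOfRecord d) (Matrix.diagonal ![(α - 1) * (α - 1), (β - 1) * (β - 1), 0]) M) ↔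
        (2 * ρ + s + d % 2 = n₁ ∧ 2 * ρ + d % 2 + 1 ≤ n₂) ∨ (2 * ρ + d % 2 = n₂ ∧ 2 * ρ + s + d % 2 < n₁) := by
  classical
  have hD' := hD
  obtain ⟨hσ, hvσ, hϖ, hfix, -, -, -⟩ := hD'
  have hϖ0 : ϖ ≠ 0 := fun h0 => by rw [h0, map_zero] at hϖ; exact WithZero.coe_ne_zero hϖ.symm
  have hα : Valued.v (α - 1) = Valued.v ϖ ^ n₂ := hE.2.2.2.2.2.2.1
  have hβ : Valued.v (β - 1) = Valued.v ϖ ^ n₁ := hE.2.2.2.2.2.1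
  have hγ : Valued.v (α - β) = Valued.v ϖ ^ n₃ := hE.2.2.2.2.2.2.2.1
  have hn₁ : N₀ ≤ n₁ := hE.2.2.2.2.2.2.2.2.1
  have hn₂ : N₀ ≤ n₂ := hE.2.2.2.2.2.2.2.2.2.1
  have hn₃ : N₀ ≤ n₃ := hE.2.2.2.2.2.2.2.2.2.2
  have hmcv : mcOfRecord d = 2 * ((d % 2 + 2 * d - 1 + d) / 2) := rfl
  rw [hmcv] at hmc ⊢
  have hq : ∀ n : ℕ, Valued.v ϖ ^ n = WithZero.exp (-(n : ℤ)) := fun n => by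
    rw [hϖ, ← WithZero.exp_nsmul]; congr 1; simp
  have hpw : ∀ a b : ℕ, Valued.v ϖ ^ a ≤ Valued.v ϖ ^ b ↔ b ≤ a := fun a b => by rw [hq, hq, WithZero.exp_le_exp]; omega
  have hpwlt : ∀ a b : ℕ, Valued.v ϖ ^ a < Valued.v ϖ ^ b ↔ b < a := fun a b => by rw [hq, hq, WithZero.exp_lt_exp]; omega
  have hpweq : ∀ a b : ℕ, Valued.v ϖ ^ a = Valued.v ϖ ^ b ↔ a = b := fun a b => by rw [hq, hq, WithZero.exp_inj]; omega
  have hv0 : ∀ k : ℕ, Valued.v (0 : K) ≤ Valued.v ϖ ^ k := fun k => by rw [map_zero]; exact zero_le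
  have hγ' : Valued.v (β - 1 - (α - 1)) = Valued.v ϖ ^ n₃ := by rw [show β - 1 - (α - 1) = -(α - β) by ring, Valuation.map_neg, hγ]
  have hγ'' : Valued.v (α - 1 - (β - 1)) = Valued.v ϖ ^ n₃ := by rw [show α - 1 - (β - 1) = α - β by ring, hγ]
  have hA2 : Valued.v ((α - 1) * (α - 1)) = Valued.v ϖ ^ (2 * n₂) := by rw [map_mul, hα, ← pow_add, two_mul]
  have hB2 : Valued.v ((β - 1) * (β - 1)) = Valued.v ϖ ^ (2 * n₁) := by rw [map_mul, hβ, ← pow_add, two_mul]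
  -- the isosceles rule of the root depths
  have hiso : min n₁ n₂ ≤ n₃ := by
    have h := Valuation.map_sub Valued.v (β - 1) (α - 1)
    rw [hγ', hβ, hα, le_max_iff, hpw, hpw] at h
    omega
  have hsqdiff : Valued.v ((β - 1) * (β - 1) - (α - 1) * (α - 1)) ≤ Valued.v ϖ ^ (n₃ + min n₁ n₂) := by
    rw [show (β - 1) * (β - 1) - (α - 1) * (α - 1) = (β - 1 - (α - 1)) * ((β - 1) + (α - 1)) by ring, map_mul, hγ', pow_add]
    refine mul_le_mul' le_rfl ((Valuation.map_add _ _ _).trans (max_le ?_ ?_))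
    · rw [hβ, hpw]; exact min_le_left _ _
    · rw [hα, hpw]; exact min_le_right _ _
  intro M hM
  rw [stratum_G1_eq hvσ hfix hϖ T hρ hs] at hM
  obtain ⟨x, ζ, y'', hx, hζ, hy, rfl, -, -⟩ := hM
  -- THE SQUARE TOKEN from `2ρ ≤ n₂`, `2ρ + s ≤ n₁`, `mc' + ρ ≤ n₃ + min n₁ n₂`, `mc' + 2ρ ≤ 2n₂`, `mc' + 2ρ + s ≤ 2n₁`
  have hsq : 2 * ρ ≤ n₂ → 2 * ρ + s ≤ n₁ → 2 * ((d % 2 + 2 * d - 1 + d) / 2) + 2 * ρ ≤ 2 * n₂ → 2 * ((d % 2 + 2 * d - 1 + d) / 2) + 2 * ρ + s ≤ 2 * n₁ →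
      LatticeInLevel ϖ (2 * ((d % 2 + 2 * d - 1 + d) / 2)) (Matrix.diagonal ![(α - 1) * (α - 1), (β - 1) * (β - 1), 0])
        (latt (!![1, 0, 0; x, ϖ ^ ρ, 0; x * ζ + y'', ϖ ^ ρ * ζ, ϖ ^ (2 * ρ + s)] : Matrix (Fin 3) (Fin 3) K)) := fun h2 h1 h2' h1' => by
    rw [latticeInLevel_diagonal_latt_G1_iff hϖ0 _ ρ s _ hx hζ y'']
    simp only [Matrix.cons_val_zero, Matrix.cons_val_one, Matrix.cons_val_two, Matrix.tail_cons, Matrix.head_cons, zero_sub, Valuation.map_neg]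
    have hmin₁ : min n₁ n₂ ≤ n₁ := min_le_left _ _
    have hmin₂ : min n₁ n₂ ≤ n₂ := min_le_right _ _
    have hN : N₀ ≤ min n₁ n₂ := le_min hn₁ hn₂
    refine ⟨⟨?_, ?_, hv0 _⟩, ?_, ?_, ?_⟩
    · rw [hA2, hpw]; omega
    · rw [hB2, hpw]; omega
    · refine hsqdiff.trans ?_
      rw [hpw]; omega
    · rw [hB2, hpw]; omega
    · refine (Valuation.map_add _ _ _).trans (max_le ?_ ?_)
      · rw [map_mul, map_mul, hx, hζ, one_mul, one_mul, Valuation.map_neg, hB2, hpw]; omega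
      · rw [map_mul, Valuation.map_neg, hA2, hy, ← pow_add, hpw]; omega
  -- the constant level reads off the foot
  have hne : Valued.v ((![α - 1, β - 1, 0] : Fin 3 → K) 2 - (![α - 1, β - 1, 0] : Fin 3 → K) 1) ≠
      Valued.v ((![α - 1, β - 1, 0] : Fin 3 → K) 2 - (![α - 1, β - 1, 0] : Fin 3 → K) 0) * Valued.v ϖ ^ s := by
    simp only [Matrix.cons_val_zero, Matrix.cons_val_one, Matrix.cons_val_two, Matrix.tail_cons, Matrix.head_cons, zero_sub, Valuation.map_neg, hα, hβ, ← pow_add]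
    rw [Ne, hpweq]; omega
  have htok : ∀ ℓ : ℕ, LatticeInLevel ϖ ℓ (Matrix.diagonal ![α - 1, β - 1, 0])
      (latt (!![1, 0, 0; x, ϖ ^ ρ, 0; x * ζ + y'', ϖ ^ ρ * ζ, ϖ ^ (2 * ρ + s)] : Matrix (Fin 3) (Fin 3) K)) ↔
        (ℓ ≤ n₂ ∧ ℓ ≤ n₁) ∧ ℓ + ρ ≤ n₃ ∧ ℓ + ρ + s ≤ n₁ ∧ (ℓ + 2 * ρ + s ≤ n₁ ∧ ℓ + 2 * ρ + s ≤ n₂ + s) := fun ℓ => by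
    rw [latticeInLevel_diagonal_latt_G1_iff_of_ne hϖ0 ℓ ρ s _ hx hζ hy hne]
    simp only [Matrix.cons_val_zero, Matrix.cons_val_one, Matrix.cons_val_two, Matrix.tail_cons, Matrix.head_cons, zero_sub, Valuation.map_neg, hv0, and_true,
      hα, hβ, hγ', ← pow_add, hpw]
  rw [htok, htok]
  constructor
  · rintro ⟨⟨⟨-, -⟩, h3, h1, h1', h2⟩, hnot, -⟩
    by_cases hb : 2 * ρ + d % 2 = n₂
    · right; exact ⟨hb, by omega⟩
    · left
      by_cases ha : 2 * ρ + s + d % 2 = n₁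
      · exact ⟨ha, by omega⟩
      · exfalso
        have hn3 : n₃ = ρ + d % 2 := by
          by_contra hc
          exact hnot ⟨⟨by omega, by omega⟩, by omega, by omega, by omega, by omega⟩
        have : min n₁ n₂ ≤ n₃ := hiso
        rcases le_total n₁ n₂ with h12 | h12
        · rw [min_eq_left h12] at this; omega
        · rw [min_eq_right h12] at this; omega
  · rintro (⟨ha, hb⟩ | ⟨hb, ha⟩)
    · have hn3 : ρ + d % 2 ≤ n₃ := by
        have : min n₁ n₂ ≤ n₃ := hiso
        rcases le_total n₁ n₂ with h12 | h12
        · rw [min_eq_left h12] at this; omega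
        · rw [min_eq_right h12] at this; omega
      exact ⟨⟨⟨by omega, by omega⟩, by omega, by omega, by omega, by omega⟩, fun h => by omega, hsq (by omega) (by omega) (by omega) (by omega)⟩
    · have hn3 : ρ + d % 2 ≤ n₃ := by
        have : min n₁ n₂ ≤ n₃ := hiso
        rcases le_total n₁ n₂ with h12 | h12
        · rw [min_eq_left h12] at this; omega
        · rw [min_eq_right h12] at this; omega
      exact ⟨⟨⟨by omega, by omega⟩, by omega, by omega, by omega, by omega⟩, fun h => by omega, hsq (by omega) (by omega) (by omega) (by omega)⟩

/-! ## §2  The zero row off the foot, off the read, off the κ-locus -/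

/-- **THE TOWER-1 ZERO ROW OFF THE FOOT**: for `ρ, s ≥ 1`, `mcOfRecord d ≤ N₀`, ANY `T`, off the glue foot `n₁ ≠ n₂ + s`, off the read `¬(2ρ + s + ℓ₀ = n₁ ∧ 2ρ + ℓ₀ + 1 ≤ n₂)` and off the
κ-locus `¬(2ρ + ℓ₀ = n₂ ∧ 2ρ + s + ℓ₀ < n₁)`, the clean-shell cut of the stratum `(2ρ, 2ρ+s, 2ρ+s)` carries `Σᶠ labelledOddCount σ ϖ 0 i Λ M ∕ w M = 0` for ANY label and weight (empty cut)
— in particular the «above» half of the β chair's `hR6₁` (`2ρ + ℓ₀ = n₂`, `n₁ < 2ρ + s + ℓ₀`, off the foot). [cite: Kottwitz1986BaseChangeUnits, §1 pp. 240–241] [cite: Rogawski1990, §4.9 Prop. 4.9.1 (a) p. 55] -/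
theorem finsum_stratum_G1_shell_eq_zero_offFoot (hD : IsRamifiedQuadraticDatum σ ϖ d t)
    (hE : IsElementDatum σ ϖ N₀ α β n₁ n₂ n₃) (hmc : mcOfRecord d ≤ N₀)
    (T : GL (Fin 3) K) (ρ s : ℕ) (hρ : 1 ≤ ρ) (hs : 1 ≤ s) (hfoot : n₁ ≠ n₂ + s)
    (hnread : ¬ (2 * ρ + s + d % 2 = n₁ ∧ 2 * ρ + d % 2 + 1 ≤ n₂)) (hnκ : ¬ (2 * ρ + d % 2 = n₂ ∧ 2 * ρ + s + d % 2 < n₁))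
    (Λ : Submodule 𝒪[K] (Fin 3 → K) → (Fin 3 → K) → Prop) (w : Submodule 𝒪[K] (Fin 3 → K) → ℚ) (i : Fin 3) :
    ∑ᶠ M ∈ {M : Submodule 𝒪[K] (Fin 3 → K) | M ∈ stratum σ ϖ T ![2 * ρ, 2 * ρ + s, 2 * ρ + s] ∧
        (LatticeInLevel ϖ (d % 2) (Matrix.diagonal ![α - 1, β - 1, 0]) M ∧ ¬ LatticeInLevel ϖ (d % 2 + 1) (Matrix.diagonal ![α - 1, β - 1, 0]) M ∧
          LatticeInLevel ϖ (mcOfRecord d) (Matrix.diagonal ![(α - 1) * (α - 1), (β - 1) * (β - 1), 0]) M)},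
      (labelledOddCount σ ϖ 0 i Λ M : ℚ) / w M = 0 := by
  classical
  rw [finsum_mem_sep_eq_ite_of_forall_iff (stratum σ ϖ T ![2 * ρ, 2 * ρ + s, 2 * ρ + s]) _ _
    (shell_iff_of_mem_stratum_G1_offFoot hD hE hmc T ρ s hρ hs hfoot), if_neg (not_or.2 ⟨hnread, hnκ⟩)]

end Summit.HodgeConjecture.HodgeConjecture.Cruxes.H413.F0P3cDyRamLabelledOddOffFootShellG1

end
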